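import Summits.ResolutionOfSingularities.ResolutionOfSingularities.Theorems.FrobeniusLadderFInjectiveMacaulayficationGradedDomainVeroneseSubalgebra
import Mathlib.Data.ZMod.Basic
import HarnessLib

/-!
# The Veronese retraction `(k[X]/J)[1/u][s] → A'` (crux `FInjectiveMacaulayfication`, line H4-gd, piece G2ᵍc)

Support file for crux stmt-ResolutionOfSingularities-15315 (`FrobeniusLadder.FInjectiveMacaulayfication`), line (H4-gd) THE
GRADED ENGINE FOR A POSITIVELY GRADED AFFINE DOMAIN OF ANY EMBEDDING CODIMENSION (CRUX-PLAN w45a v7 R7.6, typed target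
`stub_gradedDomainConeFiModel`; seat res-L1-w45a-stub-2). [OURS · L1 W4.5a] AI-written; AI review is weaker than expert review.
No statement of Hironaka2017 is used; no external fact is consumed.

This is the generalisation of `…VeroneseRetract` (res-L1-w45a-lead-1, H-G2c, hypersurface case `J = (f)`) from `k[X]/(f)` to
`k[X]/J` for an ARBITRARY ideal `J`. Setting as in `…GradedDomainCoaction` / `…GradedDomainVeroneseSubalgebra`: `L = (k[X]/J)[1/u]`
with coaction `λ`, components `(λ x)_m`; the Veronese subalgebra `A' ⊆ L[s]` = polynomials `∑ Pᵢ sⁱ` with the components of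
`Pᵢ` in degrees `≡ i (mod N')`. This file constructs the `A'`-LINEAR RETRACTION `ρ : L[s] → A'`, `∑ Pᵢ sⁱ ↦ ∑ (Pᵢ)_{≡ i} sⁱ`,
where `x_{≡ r} = ∑_{m ≡ r} (λ x)_m` is the part of `x` in the residue class `r` (the Reynolds operator of the `μ_{N'}`-action,
the input `ρ` of `FiniteGradedDescent` p173797).
* `eq_of_coeff_eq` — elements with the same components are equal;
* `coeff_classPart`, `classPart_add`, `classPart_of_mem`, `classPart_of_mem_ne`, `classPart_mem`, `sum_classPart`, `classPart_mul` —
  the calculus of the class part;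
* `exists_veroneseRetract` — the `A'`-linear retraction `ρ : L[s] →ₗ[A'] A'` with `ρ|_{A'} = id`.
The proofs are those of `…VeroneseRetract` verbatim with `Ideal.span {f}` replaced by `J`. No definitions (the class part is the
explicit finite sum), no named facts. [folklore]
-/

set_option linter.dupNamespace false

noncomputable section

open LaurentPolynomial

namespace Summit.ResolutionOfSingularities.ResolutionOfSingularities.Theorems.FInjectiveMacaulayfication.GradedDomainVeroneseRetract

open Summit.ResolutionOfSingularities.ResolutionOfSingularities.Theorems.FInjectiveMacaulayfication.GradedDomainCoaction
open Summit.ResolutionOfSingularities.ResolutionOfSingularities.Theorems.FInjectiveMacaulayfication.GradedDomainVeroneseSubalgebra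

variable {k : Type} [Field k] {n : ℕ} (w : Fin n → ℕ) (J : Ideal (MvPolynomial (Fin n) k))
variable (u : MvPolynomial (Fin n) k ⧸ J) {N : ℕ} {a₀ : MvPolynomial (Fin n) k}
  (ha₀ : MvPolynomial.IsWeightedHomogeneous w a₀ N) (hu : Ideal.Quotient.mk J a₀ = u)
variable (lam : Localization.Away u →+* (Localization.Away u)[T;T⁻¹])
variable (hlam : ∀ a : MvPolynomial (Fin n) k,
        lam (algebraMap (MvPolynomial (Fin n) k ⧸ J) _ (Ideal.Quotient.mk J a)) =
          MvPolynomial.aeval (fun j : Fin n => C (algebraMap (MvPolynomial (Fin n) k ⧸ J)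
            (Localization.Away u) (Ideal.Quotient.mk J (MvPolynomial.X j))) * T (w j : ℤ)) a)
variable (N' : ℕ)

/-! ## Components determine the element -/

section
include hlam

/-- Elements of `L` with the same weight components are equal (`T = 1`). [folklore] -/
theorem eq_of_coeff_eq {x y : Localization.Away (u : MvPolynomial (Fin n) k ⧸ J)} (h : ∀ m : ℤ, (lam x).coeff m = (lam y).coeff m) : x = y := by
  have hxy : lam x = lam y := LaurentPolynomial.ext h
  rw [← eval₂_one_coaction w J u lam hlam x, hxy, eval₂_one_coaction w J u lam hlam]

end

/-! ## The class part `x_{≡ r} = ∑_{m ≡ r} (λ x)_m` -/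

section
include ha₀ hu hlam

/-- **Components of the class part**: `(x_{≡ r})_m = x_m` if `m ≡ r`, else `0`. [folklore] -/
theorem coeff_classPart (r : ZMod N') (x : Localization.Away (u : MvPolynomial (Fin n) k ⧸ J)) (m : ℤ) :
    (lam (∑ m' ∈ (lam x).coeff.support.filter (fun m' : ℤ => (m' : ZMod N') = r), (lam x).coeff m')).coeff m =
      if (m : ZMod N') = r then (lam x).coeff m else 0 := by
  classical
  rw [coeff_map_sum lam]
  have h : ∀ m' ∈ (lam x).coeff.support.filter (fun m' : ℤ => (m' : ZMod N') = r),
      (lam ((lam x).coeff m')).coeff m = if m = m' then (lam x).coeff m' else 0 := fun m' _ =>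
    coeff_of_isHomogeneous lam (coaction_coeff w J u ha₀ hu lam hlam x m') m
  rw [Finset.sum_congr rfl h, Finset.sum_ite_eq]
  simp only [Finset.mem_filter, Finsupp.mem_support_iff]
  by_cases hm : (m : ZMod N') = r
  · rw [if_pos hm]
    by_cases h0 : (lam x).coeff m = 0
    · rw [h0]; split_ifs <;> rfl
    · rw [if_pos ⟨h0, hm⟩]
  · rw [if_neg hm, if_neg (fun h => hm h.2)]

/-- The class part is additive. [folklore] -/
theorem classPart_add (r : ZMod N') (x y : Localization.Away (u : MvPolynomial (Fin n) k ⧸ J)) :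
    (∑ m' ∈ (lam (x + y)).coeff.support.filter (fun m' : ℤ => (m' : ZMod N') = r), (lam (x + y)).coeff m') =
      (∑ m' ∈ (lam x).coeff.support.filter (fun m' : ℤ => (m' : ZMod N') = r), (lam x).coeff m') +
      ∑ m' ∈ (lam y).coeff.support.filter (fun m' : ℤ => (m' : ZMod N') = r), (lam y).coeff m' := by
  classical
  refine eq_of_coeff_eq w J u lam hlam fun m => ?_
  rw [map_add lam (∑ m' ∈ _, _), AddMonoidAlgebra.coeff_add, Finsupp.add_apply,
    coeff_classPart w J u ha₀ hu lam hlam, coeff_classPart w J u ha₀ hu lam hlam, coeff_classPart w J u ha₀ hu lam hlam,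
    map_add, AddMonoidAlgebra.coeff_add, Finsupp.add_apply]
  split_ifs <;> simp

/-- An element whose components all lie in the class `r` equals its class part. [folklore] -/
theorem classPart_of_mem (r : ZMod N') {x : Localization.Away (u : MvPolynomial (Fin n) k ⧸ J)} (hx : ∀ m : ℤ, (m : ZMod N') ≠ r → (lam x).coeff m = 0) :
    (∑ m' ∈ (lam x).coeff.support.filter (fun m' : ℤ => (m' : ZMod N') = r), (lam x).coeff m') = x := by
  classical
  refine eq_of_coeff_eq w J u lam hlam fun m => ?_
  rw [coeff_classPart w J u ha₀ hu lam hlam]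
  split_ifs with h
  · rfl
  · exact (hx m h).symm

/-- The class-`r` part of an element of class `r' ≠ r` vanishes. [folklore] -/
theorem classPart_of_mem_ne (r r' : ZMod N') (hr : r' ≠ r) {x : Localization.Away (u : MvPolynomial (Fin n) k ⧸ J)}
    (hx : ∀ m : ℤ, (m : ZMod N') ≠ r' → (lam x).coeff m = 0) :
    (∑ m' ∈ (lam x).coeff.support.filter (fun m' : ℤ => (m' : ZMod N') = r), (lam x).coeff m') = 0 := by
  classical
  refine eq_of_coeff_eq w J u lam hlam fun m => ?_
  rw [coeff_classPart w J u ha₀ hu lam hlam, map_zero, AddMonoidAlgebra.coeff_zero, Finsupp.zero_apply]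
  split_ifs with h
  · exact hx m (by rw [h]; exact hr.symm)
  · rfl

/-- The class part lies in its class. [folklore] -/
theorem classPart_mem (r : ZMod N') (x : Localization.Away (u : MvPolynomial (Fin n) k ⧸ J)) (m : ℤ) (hm : (m : ZMod N') ≠ r) :
    (lam (∑ m' ∈ (lam x).coeff.support.filter (fun m' : ℤ => (m' : ZMod N') = r), (lam x).coeff m')).coeff m = 0 := by
  rw [coeff_classPart w J u ha₀ hu lam hlam, if_neg hm]

/-- An element is the sum of its class parts (`N' > 0`). [folklore] -/
theorem sum_classPart [NeZero N'] (x : Localization.Away (u : MvPolynomial (Fin n) k ⧸ J)) :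
    ∑ r : ZMod N', (∑ m' ∈ (lam x).coeff.support.filter (fun m' : ℤ => (m' : ZMod N') = r), (lam x).coeff m') = x := by
  classical
  refine eq_of_coeff_eq w J u lam hlam fun m => ?_
  rw [coeff_map_sum lam]
  simp only [coeff_classPart w J u ha₀ hu lam hlam]
  rw [Finset.sum_ite_eq, if_pos (Finset.mem_univ _)]

/-- **The class part is linear over class-homogeneous elements**: for `a` of class `s`,
`(a y)_{≡ s + t} = a · y_{≡ t}`. [folklore] -/
theorem classPart_mul [NeZero N'] (s t : ZMod N') {a : Localization.Away (u : MvPolynomial (Fin n) k ⧸ J)}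
    (ha : ∀ m : ℤ, (m : ZMod N') ≠ s → (lam a).coeff m = 0) (y : Localization.Away u) :
    (∑ m' ∈ (lam (a * y)).coeff.support.filter (fun m' : ℤ => (m' : ZMod N') = s + t), (lam (a * y)).coeff m') =
      a * ∑ m' ∈ (lam y).coeff.support.filter (fun m' : ℤ => (m' : ZMod N') = t), (lam y).coeff m' := by
  classical
  -- components of `a · y_{≡ r}` live in class `s + r`
  have hcl : ∀ (r : ZMod N') (m : ℤ), (m : ZMod N') ≠ s + r →
      (lam (a * ∑ m' ∈ (lam y).coeff.support.filter (fun m' : ℤ => (m' : ZMod N') = r), (lam y).coeff m')).coeff m = 0 := by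
    intro r m hm
    -- expand both factors into components
    rw [eq_sum_coeff w J u lam hlam a, Finset.sum_mul, coeff_map_sum lam]
    refine Finset.sum_eq_zero fun i _ => ?_
    rw [Finset.mul_sum, coeff_map_sum lam]
    refine Finset.sum_eq_zero fun j hj => ?_
    rw [coeff_of_isHomogeneous lam (isHomogeneous_mul lam (coaction_coeff w J u ha₀ hu lam hlam a i)
      (coaction_coeff w J u ha₀ hu lam hlam y j))]
    split_ifs with h
    · subst h
      rw [Finset.mem_filter] at hj
      by_cases hi : (i : ZMod N') = s
      · exfalso; apply hm; push_cast; rw [hi, hj.2]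
      · rw [ha i hi, zero_mul]
    · rfl
  refine eq_of_coeff_eq w J u lam hlam fun m => ?_
  rw [coeff_classPart w J u ha₀ hu lam hlam]
  by_cases hm : (m : ZMod N') = s + t
  · rw [if_pos hm]
    conv_lhs => rw [← sum_classPart w J u ha₀ hu lam hlam N' y, Finset.mul_sum, coeff_map_sum lam]
    rw [Finset.sum_eq_single t]
    · intro r _ hr
      exact hcl r m (by rw [hm]; exact fun h => hr (add_left_cancel h).symm)
    · intro h; exact absurd (Finset.mem_univ t) h
  · rw [if_neg hm]
    exact (hcl t m hm).symm

end

/-! ## The retraction -/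

section
include ha₀ hu hlam

/-- **THE VERONESE RETRACTION.** For the Veronese subalgebra `A' ⊆ L[s]` (coefficient `i` of class `i mod N'`), the
map `ρ : ∑ Pᵢ sⁱ ↦ ∑ (Pᵢ)_{≡ i} sⁱ` is an `A'`-linear retraction of `L[s]` onto `A'` (`ρ|_{A'} = id`): additivity and
the module property `ρ(a P) = a ρ(P)` follow from the class-part calculus (`classPart_add`, `classPart_mul`). This
is the Reynolds operator of the `μ_{N'}`-action on `L[s]`. [folklore] -/
theorem exists_veroneseRetract [NeZero N'] (A' : Subalgebra k (Polynomial (Localization.Away (u : MvPolynomial (Fin n) k ⧸ J))))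
    (hA' : ∀ P : Polynomial (Localization.Away u),
      P ∈ A' ↔ ∀ (i : ℕ) (m : ℤ), (m : ZMod N') ≠ (i : ZMod N') → (lam (P.coeff i)).coeff m = 0) :
    ∃ ρ : Polynomial (Localization.Away u) →ₗ[A'] A', ∀ x : A', ρ x = x := by
  classical
  -- the class-part maps, bundled additively
  let cp : ZMod N' → Localization.Away u →+ Localization.Away u := fun r =>
    { toFun := fun x => ∑ m' ∈ (lam x).coeff.support.filter (fun m' : ℤ => (m' : ZMod N') = r), (lam x).coeff m'
      map_zero' := by simp
      map_add' := classPart_add w J u ha₀ hu lam hlam N' r }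
  have hcp : ∀ r x, cp r x = ∑ m' ∈ (lam x).coeff.support.filter (fun m' : ℤ => (m' : ZMod N') = r), (lam x).coeff m' :=
    fun _ _ => rfl
  -- the map on polynomials and its coefficients
  let ρ₀ : Polynomial (Localization.Away u) → Polynomial (Localization.Away u) := fun P =>
    ∑ i ∈ P.support, Polynomial.monomial i (cp (i : ZMod N') (P.coeff i))
  have hcoeff : ∀ P j, (ρ₀ P).coeff j = cp (j : ZMod N') (P.coeff j) := by
    intro P j
    simp only [ρ₀, Polynomial.finsetSum_coeff, Polynomial.coeff_monomial]
    rw [Finset.sum_ite_eq']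
    split_ifs with h
    · rfl
    · rw [Polynomial.notMem_support_iff.mp h, map_zero]
  have hmem : ∀ P, ρ₀ P ∈ A' := fun P => by
    rw [hA']
    intro i m hm
    rw [hcoeff, hcp]
    exact classPart_mem w J u ha₀ hu lam hlam N' (i : ZMod N') (P.coeff i) m hm
  have hadd : ∀ P Q, ρ₀ (P + Q) = ρ₀ P + ρ₀ Q := fun P Q => Polynomial.ext fun j => by
    rw [Polynomial.coeff_add, hcoeff, hcoeff, hcoeff, Polynomial.coeff_add, map_add]
  have hsmul : ∀ (a : A') (P : Polynomial (Localization.Away u)),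
      ρ₀ ((a : Polynomial (Localization.Away u)) * P) = (a : Polynomial (Localization.Away u)) * ρ₀ P := by
    intro a P
    refine Polynomial.ext fun j => ?_
    rw [hcoeff, Polynomial.coeff_mul, Polynomial.coeff_mul, map_sum]
    refine Finset.sum_congr rfl fun st hst => ?_
    rw [Finset.mem_antidiagonal] at hst
    rw [hcoeff, hcp, hcp, show ((j : ℕ) : ZMod N') = (st.1 : ZMod N') + (st.2 : ZMod N') by rw [← Nat.cast_add, hst]]
    exact classPart_mul w J u ha₀ hu lam hlam N' (st.1 : ZMod N') (st.2 : ZMod N') ((hA' a).mp a.2 st.1) (P.coeff st.2)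
  have hid : ∀ x : A', ρ₀ x = x := fun x => Polynomial.ext fun j => by
    rw [hcoeff, hcp]
    exact classPart_of_mem w J u ha₀ hu lam hlam N' (j : ZMod N') ((hA' x).mp x.2 j)
  refine ⟨{ toFun := fun P => ⟨ρ₀ P, hmem P⟩
            map_add' := fun P Q => Subtype.ext (hadd P Q)
            map_smul' := fun a P => Subtype.ext ?_ }, fun x => Subtype.ext (hid x)⟩
  show ρ₀ (a • P) = (((RingHom.id A') a • (⟨ρ₀ P, hmem P⟩ : A') : A') : Polynomial (Localization.Away u))
  rw [RingHom.id_apply, Subalgebra.smul_def, smul_eq_mul, smul_eq_mul, Subalgebra.coe_mul]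
  exact hsmul a P

end

end Summit.ResolutionOfSingularities.ResolutionOfSingularities.Theorems.FInjectiveMacaulayfication.GradedDomainVeroneseRetract

end
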